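import Literature.NumberTheory.CubicFields.UniformLandauShintani
import Literature.NumberTheory.CubicFields.FundCubicFieldCountLandauWeak
import Literature.NumberTheory.CubicFields.ThreeTorsionMeanFromShintani
import HarnessLib

/-!
# BTT (3) and Theorem 1.2 from Theorem 2.4 alone: the residue formulas and the functional equation

Topic `Literature/NumberTheory/CubicFields`; the capstone over `ThreeTorsionMeanFromShintani.lean`, where BTT (3) =
`btt_fundCubicFieldCount_sum` was proved from Theorem 2.4 (the residue formulas `HasPsiResidues`, `HasDivResidues`),
**Theorem 3.2** (`LandauAverageBound`, Landau's method after [LDTT]) and Prop. 4.5 (`btt_uniformity_sqDvd`). The tree now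
proves Landau's method in a Bessel-free weak form (`UniformLandauShintani.exists_landau_yform`) from the
functional-equation schema `HasShintaniFE` — the remaining clause of Theorem 2.4 (Sato–Shintani) — so Theorem 3.2
disappears from the hypotheses:

* `divCountBound_of_fe` — the large-height divisibility count (the role of Prop. 4.7 in Prop. 5.1) from the weak
  Landau bound for the single pair `(Φ_{d,m}, Y)` with `y = X/12` (error linear in `Y · Res₁`);
* `landau_block_weak` — **the `E₂` block bound**: for `1 ≤ Q₁ ≤ X^{1/3−ε}`,
  `Σ_{q ∈ [Q₁,2Q₁) sqfree} |N^s(X,Ψ_{q²}) − r₁(q)X − r₂(q)X^{5/6}| ≤ C_ε X^{2/3+ε}`, from `exists_landau_yform` with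
  `y = X^{2/3}Q₁/12`, the residue sizes `r₁ ≪ q^{−2+η}`, `Res_{5/6} ≪ q^{−5/3+η}` (Thm 2.4 (13)–(15)) and Prop. 5.1
  (`Σ_{block} δ̂₁ ≪ Q₁^{2+η}`); whence `landauShintaniDataWeak_of`;
* **`btt_fundCubicFieldCount_sum_of_thm24_fe`**, **`btt_threeTorsion_sum_of_thm24_fe`** — BTT (3), and Theorem 1.2 with
  the class-field-theory dictionary, from `h24`, `h24div` (residue formulas), `hFE` (the functional equation `HasShintaniFE` for every invariant
  nonnegative `Φ_m`) and `btt_uniformity_sqDvd`.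

## References

* M. Bhargava, T. Taniguchi, F. Thorne, *Improved error estimates for the Davenport–Heilbronn theorems*,
  Math. Ann. 389 (2024) = arXiv:2107.12819, Thm 2.4, Thm 3.1–3.2, Props. 4.5, 4.7, 5.1, §5. [BhargavaTaniguchiThorne2023]
* D. Lowry-Duda, T. Taniguchi, F. Thorne, *Uniform bounds for lattice point counting and partial sums of zeta
  functions*, Math. Z. 300 (2022) = arXiv:1710.02190. [LowrydudaTaniguchiThorne2017]
-/

noncomputable section

open Finset Real
open Literature.NumberTheory.CubicFields.LandauShintani

namespace Literature.NumberTheory.CubicFields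

open BinaryCubic ShintaniFamilyInput

/-! The functional-equation clause of Theorem 2.4 enters as the hypothesis
`hFE : ∀ m ≥ 1, ∀ Φ : V(ℤ/mℤ) → ℂ nonnegative and GL₂(ℤ/mℤ)-invariant, HasShintaniFE Φ` (spelled out in each statement;
[cite: BhargavaTaniguchiThorne2023, Thm 2.4 (analytic continuation and (eq:FE))]). -/

/-! ### Real-power bookkeeping -/

/-- `X^e (X/12)^{−e} = 12^e ≤ 12³` for `0 ≤ e ≤ 3`, `X > 0`. [folklore] -/
theorem rpow_mul_div_rpow_neg_le {X e : ℝ} (hX : 0 < X) (he : e ≤ 3) :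
    X ^ e * (X / 12) ^ (-e) ≤ (12 : ℝ) ^ (3 : ℝ) := by
  rw [Real.rpow_neg (by positivity), Real.div_rpow hX.le (by norm_num)]
  have hXe : 0 < X ^ e := Real.rpow_pos_of_pos hX e
  rw [show X ^ e * (X ^ e / (12 : ℝ) ^ e)⁻¹ = (12 : ℝ) ^ e by field_simp]
  exact Real.rpow_le_rpow_of_exponent_le (by norm_num) he

/-! ### The divisibility count from the weak Landau bound -/

/-- **The large-height divisibility count (role of BTT Prop. 4.7) from the functional equation**: there are `C, K ≥ 0`
with `#{orbits : 0 < α Disc < Y, m²d ∣ Disc} ≤ C 4^{ω(md)} Y/(m²d)` for coprime squarefree `m, d` prime to `6` and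
`Y ≥ K(m²d)⁵` — as `divCountBound_of_landau`, with Theorem 3.2 replaced by `exists_landau_yform` for the pair
`(Φ_{d,m}, ⌈Y⌉)` and `y = ⌈Y⌉/12`: the error is `≪ Y(Res₁⁺ + Res₁⁻) + δ̂₁ ≪ Y · 2^{ω}/(m²d)`.
[cite: BhargavaTaniguchiThorne2023, Prop. 4.7 (its use for N > Q^{100} in §5) with Thm 2.4 (cases Φ_p, Φ_{p²}) and Thm 3.1] -/
theorem divCountBound_of_fe (hU : btt_uniformity_sqDvd) (hFE : ∀ (M : ℕ) [NeZero M] (Φ : BinaryCubic (ZMod M) → ℂ), (∀ y, 0 ≤ (Φ y).re ∧ (Φ y).im = 0) →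
      (∀ γ : Matrix (Fin 2) (Fin 2) (ZMod M), IsUnit γ.det → ∀ y, Φ (twist γ y) = Φ y) → HasShintaniFE Φ)
    (h24div : ∀ d m : ℕ, Squarefree d → Squarefree m → d.Coprime m → (d * m).Coprime 6 →
      ∀ sgn : ℤ, (sgn = 1 ∨ sgn = -1) → HasDivResidues d m sgn) :
    ∃ C K : ℝ, 0 ≤ C ∧ 0 ≤ K ∧ DivCountBound C K := by
  obtain ⟨C_h, hCh⟩ := exists_sum_classNumber_le hU
  have hCh0 : 0 ≤ C_h := by
    have h := hCh 1 (Or.inl rfl) 1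
    have h0 : 0 ≤ ∑ D ∈ discWindow 1 1, (classNumber D : ℝ) := Finset.sum_nonneg fun _ _ => Nat.cast_nonneg _
    simpa using h0.trans h
  have hβ := shintaniBeta_pos
  set Γ : ℝ := |shintaniGamma 1| + |shintaniGamma (-1)| with hΓ
  set c₁₆ : ℝ := Γ / shintaniBeta + 1 with hc₁₆
  have hc₁₆0 : 0 < c₁₆ := by rw [hc₁₆]; positivity
  obtain ⟨C_y, hCy, hy⟩ := exists_landau_yform hU (η := 1 / 16) (by norm_num) le_rfl
  set K : ℝ := max 1 (2 * C_h / shintaniBeta) with hK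
  have hK1 : 1 ≤ K := le_max_left _ _
  have hK2 : 2 * C_h / shintaniBeta ≤ K := le_max_right _ _
  set A : ℝ := shintaniAlpha (-1) + shintaniBeta with hA
  have hA0 : 0 < A := add_pos (shintaniAlpha_pos (-1)) hβ
  set L : ℝ := 2 + 12 / 5 * c₁₆ + C_y * (8 + 8 * c₁₆ + (1 + (12 : ℝ) ^ (3 : ℝ))) with hL
  have hL0 : 0 ≤ L := by positivity
  refine ⟨12 * L * (2 * A), K, by positivity, by linarith, ?_⟩
  intro α hα m d hm hd hmd h6 Y hY
  -- the level and the function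
  have hm0 : (0 : ℝ) < m := by exact_mod_cast Nat.pos_of_ne_zero hm.ne_zero
  have hd0 : (0 : ℝ) < d := by exact_mod_cast Nat.pos_of_ne_zero hd.ne_zero
  set M : ℕ := m ^ 2 * d with hMdef
  have hMr : (M : ℝ) = (m : ℝ) ^ 2 * d := by rw [hMdef]; push_cast; ring
  have hM0 : (0 : ℝ) < (m : ℝ) ^ 2 * d := by positivity
  have hMpos : 0 < M := by rw [hMdef]; exact Nat.pos_of_ne_zero (mul_ne_zero (pow_ne_zero 2 hm.ne_zero) hd.ne_zero)
  haveI : NeZero M := ⟨hMpos.ne'⟩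
  have hm6 : m.Coprime 6 := Nat.Coprime.coprime_dvd_left (Dvd.intro d rfl) h6
  have hd6 : d.Coprime 6 := Nat.Coprime.coprime_dvd_left (Dvd.intro_left m rfl) h6
  have hres : ∀ σ : ℤ, (σ = 1 ∨ σ = -1) → HasDivResidues d m σ :=
    fun σ hσ => h24div d m hd hm hmd.symm (by rwa [mul_comm]) σ hσ
  -- heights
  have hM5 : ((m : ℝ) ^ 2 * d) ^ 5 ≤ Y := le_trans (le_mul_of_one_le_left (by positivity) hK1) hY
  have hY1 : (1 : ℝ) ≤ Y := by
    refine le_trans ?_ hM5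
    have h1 : (1 : ℝ) ≤ (m : ℝ) ^ 2 * d := by
      have := Nat.one_le_iff_ne_zero.mpr hMpos.ne'
      rw [← hMr]; exact_mod_cast this
    exact one_le_pow₀ h1
  have hY0 : 0 < Y := by linarith
  -- the integer height `X = ⌈Y⌉` and `y = X/12`
  set X : ℕ := ⌈Y⌉₊ with hXdef
  have hXY : Y ≤ X := Nat.le_ceil Y
  have hX1 : 1 ≤ X := by
    have : (1 : ℝ) ≤ X := hY1.trans hXY
    exact_mod_cast this
  have hX1r : (1 : ℝ) ≤ X := by exact_mod_cast hX1
  have hX0 : (0 : ℝ) < X := by linarith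
  have hX2Y : (X : ℝ) ≤ 2 * Y := by
    have := (Nat.ceil_lt_add_one hY0.le).le; rw [← hXdef] at this; linarith
  set yv : ℝ := (X : ℝ) / 12 with hyv
  have hyv0 : 0 < yv := by positivity
  have hyv12 : 12 * yv ≤ X := by rw [hyv]; linarith
  have hyv1 : yv + 1 ≤ 2 * X := by rw [hyv]; linarith
  -- the residues (both signs) and the dual density
  set Φ := divIndicator d m with hΦ
  set W : ℝ := A * 2 ^ (m * d).primeFactors.card / ((m : ℝ) ^ 2 * d) with hW
  have hW0 : 0 < W := by positivity
  have hR : ∀ σ : ℤ, (σ = 1 ∨ σ = -1) → ‖shintaniRes1 Φ σ‖ = (shintaniRes1 Φ σ).re ∧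
      shintaniBeta / ((m : ℝ) ^ 2 * d) ≤ (shintaniRes1 Φ σ).re ∧ (shintaniRes1 Φ σ).re ≤ W ∧
      ‖shintaniRes56 Φ σ‖ ≤ c₁₆ * Y ^ ((1 : ℝ) / 6) * ‖shintaniRes1 Φ σ‖ := by
    intro σ hσ
    have h := hres σ hσ
    refine ⟨by rw [h.norm_shintaniRes1, h.re_shintaniRes1], h.lower hd hm, ?_, h.hyp16 hσ hd hm hd6 hm6 hM5⟩
    exact h.upper hd hm hmd
  obtain ⟨hRn, hRlow, hRup, h16⟩ := hR α hα
  set Rα : ℝ := (shintaniRes1 Φ α).re with hRα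
  have hRα0 : 0 < Rα := lt_of_lt_of_le (by positivity) hRlow
  have hsumR1 : ‖shintaniRes1 Φ 1‖ + ‖shintaniRes1 Φ (-1)‖ ≤ 2 * W := by
    obtain ⟨e1, -, u1, -⟩ := hR 1 (Or.inl rfl)
    obtain ⟨e2, -, u2, -⟩ := hR (-1) (Or.inr rfl)
    rw [e1, e2]; linarith
  have hsumR56 : ‖shintaniRes56 Φ 1‖ + ‖shintaniRes56 Φ (-1)‖ ≤ c₁₆ * Y ^ ((1 : ℝ) / 6) * (2 * W) := by
    obtain ⟨e1, -, u1, f1⟩ := hR 1 (Or.inl rfl)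
    obtain ⟨e2, -, u2, f2⟩ := hR (-1) (Or.inr rfl)
    have hc : 0 ≤ c₁₆ * Y ^ ((1 : ℝ) / 6) := by positivity
    calc ‖shintaniRes56 Φ 1‖ + ‖shintaniRes56 Φ (-1)‖
        ≤ c₁₆ * Y ^ ((1 : ℝ) / 6) * ‖shintaniRes1 Φ 1‖ + c₁₆ * Y ^ ((1 : ℝ) / 6) * ‖shintaniRes1 Φ (-1)‖ := add_le_add f1 f2
      _ = c₁₆ * Y ^ ((1 : ℝ) / 6) * (‖shintaniRes1 Φ 1‖ + ‖shintaniRes1 Φ (-1)‖) := by ring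
      _ ≤ c₁₆ * Y ^ ((1 : ℝ) / 6) * (2 * W) := mul_le_mul_of_nonneg_left hsumR1 hc
  have hδ : dualDensity Φ ≤ (M : ℝ) ^ 4 * (2 * 1 * C_h) :=
    dualDensity_le_explicit hCh zero_le_one (norm_divIndicator_le d m)
  have hδ0 : 0 ≤ dualDensity Φ := dualDensity_nonneg _
  have hD : dualDensity Φ ≤ Y * W := by
    refine hδ.trans ?_
    rw [hMr]
    have h1 : ((m : ℝ) ^ 2 * d) ^ 4 * (2 * 1 * C_h) ≤ Y * (shintaniBeta / ((m : ℝ) ^ 2 * d)) := by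
      rw [mul_div_assoc', le_div_iff₀ hM0]
      calc ((m : ℝ) ^ 2 * d) ^ 4 * (2 * 1 * C_h) * ((m : ℝ) ^ 2 * d) = (2 * C_h / shintaniBeta) * ((m : ℝ) ^ 2 * d) ^ 5 * shintaniBeta := by
            field_simp
          _ ≤ K * ((m : ℝ) ^ 2 * d) ^ 5 * shintaniBeta := by gcongr
          _ ≤ Y * shintaniBeta := mul_le_mul_of_nonneg_right hY hβ.le
    exact h1.trans (mul_le_mul_of_nonneg_left (hRlow.trans hRup) hY0.le)
  -- the weak Landau bound for `(Φ, X, y)`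
  have hmain := hy M Φ (fun y => divIndicator_nonneg d m y) (hFE M Φ (fun y => divIndicator_nonneg d m y)
    (fun γ hγ y => divIndicator_twist d m hγ y)) α hα X yv hX1 hyv0 hyv12
  -- the error is `≤ C_y (8 + 8 c₁₆ + 1 + 12³) W Y`
  have hX6 : (X : ℝ) ^ (-(1 : ℝ) / 6) * Y ^ ((1 : ℝ) / 6) ≤ 1 := by
    have h1 : (X : ℝ) ^ (-(1 : ℝ) / 6) ≤ Y ^ (-(1 : ℝ) / 6) := Real.rpow_le_rpow_of_nonpos hY0 hXY (by norm_num)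
    calc (X : ℝ) ^ (-(1 : ℝ) / 6) * Y ^ ((1 : ℝ) / 6) ≤ Y ^ (-(1 : ℝ) / 6) * Y ^ ((1 : ℝ) / 6) :=
          mul_le_mul_of_nonneg_right h1 (by positivity)
      _ = 1 := by rw [← Real.rpow_add hY0]; norm_num
  have hpow : (X : ℝ) ^ (2 + 4 * (1 / 16 : ℝ)) * yv ^ (-(2 + 4 * (1 / 16 : ℝ))) ≤ (12 : ℝ) ^ (3 : ℝ) :=
    rpow_mul_div_rpow_neg_le hX0 (by norm_num)
  have herr : C_y * ((yv + 1) * (‖shintaniRes1 Φ 1‖ + ‖shintaniRes1 Φ (-1)‖)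
      + (yv + 1) * (X : ℝ) ^ (-(1 : ℝ) / 6) * (‖shintaniRes56 Φ 1‖ + ‖shintaniRes56 Φ (-1)‖)
      + dualDensity Φ * (1 + (X : ℝ) ^ (2 + 4 * (1 / 16 : ℝ)) * yv ^ (-(2 + 4 * (1 / 16 : ℝ)))))
      ≤ C_y * (8 + 8 * c₁₆ + (1 + (12 : ℝ) ^ (3 : ℝ))) * (W * Y) := by
    have t1 : (yv + 1) * (‖shintaniRes1 Φ 1‖ + ‖shintaniRes1 Φ (-1)‖) ≤ 8 * (W * Y) := by
      calc (yv + 1) * (‖shintaniRes1 Φ 1‖ + ‖shintaniRes1 Φ (-1)‖) ≤ (2 * X) * (2 * W) := by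
            gcongr
        _ ≤ (2 * (2 * Y)) * (2 * W) := by gcongr
        _ = 8 * (W * Y) := by ring
    have t2 : (yv + 1) * (X : ℝ) ^ (-(1 : ℝ) / 6) * (‖shintaniRes56 Φ 1‖ + ‖shintaniRes56 Φ (-1)‖) ≤ 8 * c₁₆ * (W * Y) := by
      calc (yv + 1) * (X : ℝ) ^ (-(1 : ℝ) / 6) * (‖shintaniRes56 Φ 1‖ + ‖shintaniRes56 Φ (-1)‖)
          ≤ (2 * X) * (X : ℝ) ^ (-(1 : ℝ) / 6) * (c₁₆ * Y ^ ((1 : ℝ) / 6) * (2 * W)) := by gcongr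
        _ = 4 * c₁₆ * X * W * ((X : ℝ) ^ (-(1 : ℝ) / 6) * Y ^ ((1 : ℝ) / 6)) := by ring
        _ ≤ 4 * c₁₆ * X * W * 1 := by gcongr
        _ ≤ 4 * c₁₆ * (2 * Y) * W * 1 := by gcongr
        _ = 8 * c₁₆ * (W * Y) := by ring
    have t3 : dualDensity Φ * (1 + (X : ℝ) ^ (2 + 4 * (1 / 16 : ℝ)) * yv ^ (-(2 + 4 * (1 / 16 : ℝ))))
        ≤ (1 + (12 : ℝ) ^ (3 : ℝ)) * (W * Y) := by
      calc dualDensity Φ * (1 + (X : ℝ) ^ (2 + 4 * (1 / 16 : ℝ)) * yv ^ (-(2 + 4 * (1 / 16 : ℝ))))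
          ≤ (Y * W) * (1 + (12 : ℝ) ^ (3 : ℝ)) := by gcongr
        _ = (1 + (12 : ℝ) ^ (3 : ℝ)) * (W * Y) := by ring
    calc _ ≤ C_y * (8 * (W * Y) + 8 * c₁₆ * (W * Y) + (1 + (12 : ℝ) ^ (3 : ℝ)) * (W * Y)) :=
          mul_le_mul_of_nonneg_left (add_le_add (add_le_add t1 t2) t3) hCy.le
      _ = _ := by ring
  -- the norm of the partial sum
  set Nval : ℂ := shintaniPartialSum Φ α (X : ℝ) with hNval
  have hNY : shintaniPartialSum Φ α Y = Nval := by
    rw [hNval, shintaniPartialSum, shintaniPartialSum, Nat.ceil_natCast]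
  set A' : ℂ := shintaniRes1 Φ α * ((X : ℝ) : ℂ) with hA'
  set B' : ℂ := (6 / 5 : ℂ) * shintaniRes56 Φ α * ((((X : ℝ)) ^ ((5 : ℝ) / 6) : ℝ) : ℂ) with hB'
  have hA'norm : ‖A'‖ ≤ W * (2 * Y) := by
    rw [hA', norm_mul, hRn, Complex.norm_real, Real.norm_of_nonneg hX0.le]
    exact mul_le_mul hRup hX2Y hX0.le hW0.le
  have hB'norm : ‖B'‖ ≤ 12 / 5 * c₁₆ * (W * Y) := by
    rw [hB', norm_mul, norm_mul, Complex.norm_real, Real.norm_of_nonneg (Real.rpow_nonneg hX0.le _),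
      show (6 / 5 : ℂ) = ((6 / 5 : ℝ) : ℂ) by push_cast; ring, Complex.norm_real, Real.norm_of_nonneg (by norm_num)]
    have hX56 : (X : ℝ) ^ ((5 : ℝ) / 6) ≤ 2 * Y ^ ((5 : ℝ) / 6) := by
      calc (X : ℝ) ^ ((5 : ℝ) / 6) ≤ (2 * Y) ^ ((5 : ℝ) / 6) := Real.rpow_le_rpow hX0.le hX2Y (by norm_num)
        _ = (2 : ℝ) ^ ((5 : ℝ) / 6) * Y ^ ((5 : ℝ) / 6) := Real.mul_rpow (by norm_num) hY0.le
        _ ≤ 2 * Y ^ ((5 : ℝ) / 6) := by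
            gcongr
            calc (2 : ℝ) ^ ((5 : ℝ) / 6) ≤ (2 : ℝ) ^ (1 : ℝ) := Real.rpow_le_rpow_of_exponent_le (by norm_num) (by norm_num)
              _ = 2 := Real.rpow_one 2
    rw [hRn] at h16
    calc 6 / 5 * ‖shintaniRes56 Φ α‖ * (X : ℝ) ^ ((5 : ℝ) / 6) ≤ 6 / 5 * (c₁₆ * Y ^ ((1 : ℝ) / 6) * Rα) * (2 * Y ^ ((5 : ℝ) / 6)) := by
          gcongr
      _ = 12 / 5 * c₁₆ * Rα * (Y ^ ((1 : ℝ) / 6) * Y ^ ((5 : ℝ) / 6)) := by ring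
      _ = 12 / 5 * c₁₆ * Rα * Y := by rw [rpow_sixth_mul_rpow_five_sixths hY0.le]
      _ ≤ 12 / 5 * c₁₆ * W * Y := by gcongr
      _ = 12 / 5 * c₁₆ * (W * Y) := by ring
  have hNnorm : ‖Nval‖ ≤ L * (W * Y) := by
    have htri : ‖Nval‖ ≤ ‖Nval - A' - B'‖ + ‖A'‖ + ‖B'‖ := by
      have h : ‖(Nval - A' - B') + A' + B'‖ ≤ ‖Nval - A' - B'‖ + ‖A'‖ + ‖B'‖ := norm_add₃_le
      rwa [show Nval - A' - B' + A' + B' = Nval by ring] at h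
    have h1 : ‖Nval - A' - B'‖ ≤ C_y * (8 + 8 * c₁₆ + (1 + (12 : ℝ) ^ (3 : ℝ))) * (W * Y) := hmain.trans herr
    calc ‖Nval‖ ≤ ‖Nval - A' - B'‖ + ‖A'‖ + ‖B'‖ := htri
      _ ≤ C_y * (8 + 8 * c₁₆ + (1 + (12 : ℝ) ^ (3 : ℝ))) * (W * Y) + W * (2 * Y) + 12 / 5 * c₁₆ * (W * Y) :=
          add_le_add (add_le_add h1 hA'norm) hB'norm
      _ = L * (W * Y) := by rw [hL]; ring
  -- conclusion
  have hcount := ncard_divFam_le_re_partialSum hα hmd Y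
  rw [hNY] at hcount
  have h2le4 : (2 : ℝ) ^ (m * d).primeFactors.card ≤ 4 ^ (m * d).primeFactors.card :=
    pow_le_pow_left₀ (by norm_num) (by norm_num) _
  calc ((divFam α Y m d ∅ ∅).ncard : ℝ) ≤ 12 * Nval.re := hcount
    _ ≤ 12 * ‖Nval‖ := mul_le_mul_of_nonneg_left (Complex.re_le_norm _) (by norm_num)
    _ ≤ 12 * (L * (W * Y)) := mul_le_mul_of_nonneg_left hNnorm (by norm_num)
    _ = 12 * L * Y * (A * 2 ^ (m * d).primeFactors.card / ((m : ℝ) ^ 2 * d)) := by rw [hW]; ring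
    _ ≤ 12 * L * Y * (2 * A * 4 ^ (m * d).primeFactors.card / ((m : ℝ) ^ 2 * d)) := by
        refine mul_le_mul_of_nonneg_left ?_ (by positivity)
        refine div_le_div_of_nonneg_right ?_ hM0.le
        calc A * 2 ^ (m * d).primeFactors.card ≤ A * 4 ^ (m * d).primeFactors.card := mul_le_mul_of_nonneg_left h2le4 hA0.le
          _ ≤ 2 * A * 4 ^ (m * d).primeFactors.card := by
              have h4 : 0 ≤ A * 4 ^ (m * d).primeFactors.card := by positivity
              linarith
    _ = 12 * L * (2 * A) * 4 ^ (m * d).primeFactors.card * Y / ((m : ℝ) ^ 2 * d) := by ring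


/-! ### The `E₂` block bound from the weak Landau method -/

/-- **BTT §5, the `E₂` paragraph, from the functional equation (weak Landau) + the residue sizes + Prop. 5.1**: for
`0 < ε` there is `C` with, for `1 ≤ Q₁ ≤ X^{1/3−ε}`,
`Σ_{q ∈ [Q₁,2Q₁) sqfree} |N^s(X,Ψ_{q²}) − (α^s+β)𝒜_q X − (6/5)γ^s 𝒞_q X^{5/6}| ≤ C X^{2/3+ε}`
(`exists_landau_yform` with `y = X^{2/3}Q₁/12`; `Σ_block Res₁ ≪ Q₁^{−1+η}`, `Σ_block Res_{5/6} ≪ Q₁^{−2/3+η}`,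
`Σ_block δ̂₁ ≪ Q₁^{2+η}` (Prop. 5.1); BTT's `X^{3/5}Q₁^{1/5+ε}` needs Theorem 3.2 proper).
[cite: BhargavaTaniguchiThorne2023, §5 (E₂ paragraph) with Thm 3.1 and Prop. 5.1] -/
theorem landau_block_weak
    (h24 : ∀ q : ℕ, Squarefree q → ∀ sgn : ℤ, (sgn = 1 ∨ sgn = -1) → HasPsiResidues q sgn)
    (hFE : ∀ (M : ℕ) [NeZero M] (Φ : BinaryCubic (ZMod M) → ℂ), (∀ y, 0 ≤ (Φ y).re ∧ (Φ y).im = 0) →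
      (∀ γ : Matrix (Fin 2) (Fin 2) (ZMod M), IsUnit γ.det → ∀ y, Φ (twist γ y) = Φ y) → HasShintaniFE Φ) (h51 : ∀ ε : ℝ, 0 < ε → ∃ C : ℝ, DualDensityPsiBound ε C) (hU : btt_uniformity_sqDvd)
    {s : ℤ} (hs : s = 1 ∨ s = -1) (ε : ℝ) (hε : 0 < ε) :
    ∃ C : ℝ, ∀ X : ℕ, 1 ≤ X → ∀ Q₁ : ℕ, 1 ≤ Q₁ → (Q₁ : ℝ) ≤ (X : ℝ) ^ ((1 : ℝ) / 3 - ε) →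
      ∑ q ∈ (Finset.Ico Q₁ (2 * Q₁)).filter Squarefree,
          |nonFundCount s q X - (shintaniAlpha s + shintaniBeta) * resFactor1 q * X
            - 6 / 5 * (shintaniGamma s * resFactor56 q) * (X : ℝ) ^ ((5 : ℝ) / 6)|
        ≤ C * (X : ℝ) ^ ((2 : ℝ) / 3 + ε) := by
  -- the auxiliary exponent `η`: `8η ≤ ε`, `η ≤ 1/16`
  set η : ℝ := min ε (1 / 16) / 8 with hη
  have hη0 : 0 < η := by rw [hη]; exact div_pos (lt_min hε (by norm_num)) (by norm_num)
  have hη16 : η ≤ 1 / 16 := by rw [hη]; linarith [min_le_right ε (1 / 16), le_min hε.le (by norm_num : (0:ℝ) ≤ 1 / 16)]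
  have hηε : 8 * η ≤ ε := by rw [hη]; linarith [min_le_left ε (1 / 16)]
  have hε1 : ε ≤ 1 / 3 ∨ 1 / 3 < ε := le_or_gt ε (1 / 3)
  obtain ⟨C_y, hCy, hy⟩ := exists_landau_yform hU hη0 hη16
  obtain ⟨C₁p, hC₁p⟩ := exists_r₁_le 1 hη0
  obtain ⟨C₁m, hC₁m⟩ := exists_r₁_le (-1) hη0
  obtain ⟨C₂p, hC₂p⟩ := exists_r₂_le 1 hη0
  obtain ⟨C₂m, hC₂m⟩ := exists_r₂_le (-1) hη0
  obtain ⟨C_P, hP⟩ := h51 η hη0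
  set C₁ : ℝ := max C₁p 0 + max C₁m 0 with hC₁
  set C₂ : ℝ := max C₂p 0 + max C₂m 0 with hC₂
  set C_P' : ℝ := max C_P 0 with hC_P'
  have hC₁0 : 0 ≤ C₁ := by positivity
  have hC₂0 : 0 ≤ C₂ := by positivity
  have hC_P'0 : 0 ≤ C_P' := le_max_right _ _
  refine ⟨C_y * (2 * C₁ + 2 * C₂ + C_P' * (1 + (12 : ℝ) ^ (3 : ℝ))), fun X hX Q₁ hQ₁ hQX => ?_⟩
  set I := (Finset.Ico Q₁ (2 * Q₁)).filter Squarefree with hI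
  have hX1 : (1 : ℝ) ≤ X := by exact_mod_cast hX
  have hX0 : (0 : ℝ) < X := by linarith
  have hQ1 : (1 : ℝ) ≤ Q₁ := by exact_mod_cast hQ₁
  have hQ0 : (0 : ℝ) < Q₁ := by linarith
  have hQX3 : (Q₁ : ℝ) ≤ (X : ℝ) ^ ((1 : ℝ) / 3) := hQX.trans (Real.rpow_le_rpow_of_exponent_le hX1 (by linarith))
  set P : ℝ := (X : ℝ) ^ ((2 : ℝ) / 3 + ε) with hPdef
  have hP0 : 0 < P := Real.rpow_pos_of_pos hX0 _
  -- `y = X^{2/3} Q₁ / 12`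
  set y : ℝ := (X : ℝ) ^ ((2 : ℝ) / 3) * Q₁ / 12 with hydef
  have hX23 : (1 : ℝ) ≤ (X : ℝ) ^ ((2 : ℝ) / 3) := Real.one_le_rpow hX1 (by norm_num)
  have hy0 : 0 < y := by positivity
  have hy12 : 12 * y ≤ X := by
    rw [hydef]
    calc 12 * ((X : ℝ) ^ ((2 : ℝ) / 3) * Q₁ / 12) = (X : ℝ) ^ ((2 : ℝ) / 3) * Q₁ := by ring
      _ ≤ (X : ℝ) ^ ((2 : ℝ) / 3) * (X : ℝ) ^ ((1 : ℝ) / 3) := mul_le_mul_of_nonneg_left hQX3 (by positivity)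
      _ = X := by rw [← Real.rpow_add hX0]; norm_num
  have hy1 : y + 1 ≤ 13 * y := by
    have h1 : (1 : ℝ) ≤ (X : ℝ) ^ ((2 : ℝ) / 3) * Q₁ := one_le_mul_of_one_le_of_one_le hX23 hQ1
    have : 1 / 12 ≤ y := by rw [hydef]; linarith
    linarith
  -- the members of the block
  have hmem : ∀ q ∈ I, |nonFundCount s q X - (shintaniAlpha s + shintaniBeta) * resFactor1 q * X
      - 6 / 5 * (shintaniGamma s * resFactor56 q) * (X : ℝ) ^ ((5 : ℝ) / 6)|
      ≤ C_y * ((y + 1) * (‖shintaniRes1 (psiMod q) 1‖ + ‖shintaniRes1 (psiMod q) (-1)‖)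
          + (y + 1) * (X : ℝ) ^ (-(1 : ℝ) / 6) * (‖shintaniRes56 (psiMod q) 1‖ + ‖shintaniRes56 (psiMod q) (-1)‖)
          + dualDensity (psiMod q) * (1 + (X : ℝ) ^ (2 + 4 * η) * y ^ (-(2 + 4 * η)))) := by
    intro q hq
    obtain ⟨hqsf, -, -, hq0⟩ := mem_block hQ₁ hq
    haveI : NeZero (16 * q ^ 2) := ⟨by have := hqsf.ne_zero; positivity⟩
    have hFEq := hFE (16 * q ^ 2) (psiMod q) (psiMod_nonneg q) (fun γ hγ y => psiMod_twist q hγ y)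
    have h := hy (16 * q ^ 2) (psiMod q) (psiMod_nonneg q) hFEq s hs X y hX hy0 hy12
    rw [shintaniPartialSum_psiMod hs, (h24 q hqsf s hs).shintaniRes1_eq, (h24 q hqsf s hs).shintaniRes56_eq] at h
    have hcast : ((nonFundCount s q X : ℝ) : ℂ)
        - (((shintaniAlpha s + shintaniBeta) * resFactor1 q : ℝ) : ℂ) * ((X : ℝ) : ℂ)
        - 6 / 5 * ((shintaniGamma s * resFactor56 q : ℝ) : ℂ) * ((((X : ℝ) ^ ((5 : ℝ) / 6)) : ℝ) : ℂ)
        = ((nonFundCount s q X - (shintaniAlpha s + shintaniBeta) * resFactor1 q * X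
            - 6 / 5 * (shintaniGamma s * resFactor56 q) * (X : ℝ) ^ ((5 : ℝ) / 6) : ℝ) : ℂ) := by
      push_cast; ring
    rwa [hcast, Complex.norm_real, Real.norm_eq_abs] at h
  -- the residue sizes on the block
  have hR1 : ∀ q ∈ I, ‖shintaniRes1 (psiMod q) 1‖ + ‖shintaniRes1 (psiMod q) (-1)‖ ≤ C₁ * (Q₁ : ℝ) ^ (-2 + η) := by
    intro q hq
    obtain ⟨hqsf, hQq, -, hq0⟩ := mem_block hQ₁ hq
    have hqQ : (q : ℝ) ^ (-2 + η) ≤ (Q₁ : ℝ) ^ (-2 + η) := Real.rpow_le_rpow_of_nonpos hQ0 hQq (by linarith)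
    rw [(h24 q hqsf 1 (Or.inl rfl)).norm_shintaniRes1, (h24 q hqsf (-1) (Or.inr rfl)).norm_shintaniRes1]
    have h1 := (le_abs_self _).trans (hC₁p q hqsf)
    have h2 := (le_abs_self _).trans (hC₁m q hqsf)
    have hq' : 0 ≤ (q : ℝ) ^ (-2 + η) := by positivity
    calc (shintaniAlpha 1 + shintaniBeta) * resFactor1 q + (shintaniAlpha (-1) + shintaniBeta) * resFactor1 q
        ≤ C₁p * (q : ℝ) ^ (-2 + η) + C₁m * (q : ℝ) ^ (-2 + η) := add_le_add h1 h2
      _ ≤ max C₁p 0 * (q : ℝ) ^ (-2 + η) + max C₁m 0 * (q : ℝ) ^ (-2 + η) := by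
          gcongr <;> exact le_max_left _ _
      _ = C₁ * (q : ℝ) ^ (-2 + η) := by rw [hC₁]; ring
      _ ≤ C₁ * (Q₁ : ℝ) ^ (-2 + η) := mul_le_mul_of_nonneg_left hqQ hC₁0
  have hR2 : ∀ q ∈ I, ‖shintaniRes56 (psiMod q) 1‖ + ‖shintaniRes56 (psiMod q) (-1)‖ ≤ C₂ * (Q₁ : ℝ) ^ (-(5 : ℝ) / 3 + η) := by
    intro q hq
    obtain ⟨hqsf, hQq, -, hq0⟩ := mem_block hQ₁ hq
    have hqQ : (q : ℝ) ^ (-(5 : ℝ) / 3 + η) ≤ (Q₁ : ℝ) ^ (-(5 : ℝ) / 3 + η) :=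
      Real.rpow_le_rpow_of_nonpos hQ0 hQq (by linarith)
    rw [(h24 q hqsf 1 (Or.inl rfl)).norm_shintaniRes56, (h24 q hqsf (-1) (Or.inr rfl)).norm_shintaniRes56]
    have e : ∀ x : ℝ, |x| ≤ |6 / 5 * x| := fun x => by rw [abs_mul, abs_of_pos (by norm_num : (0:ℝ) < 6 / 5)]; linarith [abs_nonneg x]
    have h1 := (e _).trans (hC₂p q hqsf)
    have h2 := (e _).trans (hC₂m q hqsf)
    have hq' : 0 ≤ (q : ℝ) ^ (-(5 : ℝ) / 3 + η) := by positivity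
    calc |shintaniGamma 1 * resFactor56 q| + |shintaniGamma (-1) * resFactor56 q|
        ≤ C₂p * (q : ℝ) ^ (-(5 : ℝ) / 3 + η) + C₂m * (q : ℝ) ^ (-(5 : ℝ) / 3 + η) := add_le_add h1 h2
      _ ≤ max C₂p 0 * (q : ℝ) ^ (-(5 : ℝ) / 3 + η) + max C₂m 0 * (q : ℝ) ^ (-(5 : ℝ) / 3 + η) := by
          gcongr <;> exact le_max_left _ _
      _ = C₂ * (q : ℝ) ^ (-(5 : ℝ) / 3 + η) := by rw [hC₂]; ring
      _ ≤ C₂ * (Q₁ : ℝ) ^ (-(5 : ℝ) / 3 + η) := mul_le_mul_of_nonneg_left hqQ hC₂0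
  have hcard : (I.card : ℝ) ≤ Q₁ := by
    have h : I.card ≤ (Finset.Ico Q₁ (2 * Q₁)).card := Finset.card_filter_le _ _
    rw [Nat.card_Ico] at h
    have : I.card ≤ Q₁ := by omega
    exact_mod_cast this
  have hD : ∑ q ∈ I, dualDensity (psiMod q) ≤ C_P' * (Q₁ : ℝ) ^ (2 + η) :=
    (sum_Ico_dualDensity_le hP hQ₁).trans (mul_le_mul_of_nonneg_right (le_max_left _ _) (by positivity))
  -- summing the member bounds
  have hsum : ∑ q ∈ I, |nonFundCount s q X - (shintaniAlpha s + shintaniBeta) * resFactor1 q * X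
      - 6 / 5 * (shintaniGamma s * resFactor56 q) * (X : ℝ) ^ ((5 : ℝ) / 6)|
      ≤ C_y * ((y + 1) * (Q₁ * (C₁ * (Q₁ : ℝ) ^ (-2 + η)))
          + (y + 1) * (X : ℝ) ^ (-(1 : ℝ) / 6) * (Q₁ * (C₂ * (Q₁ : ℝ) ^ (-(5 : ℝ) / 3 + η)))
          + C_P' * (Q₁ : ℝ) ^ (2 + η) * (1 + (X : ℝ) ^ (2 + 4 * η) * y ^ (-(2 + 4 * η)))) := by
    refine (Finset.sum_le_sum hmem).trans ?_
    rw [← Finset.mul_sum, Finset.sum_add_distrib, Finset.sum_add_distrib, ← Finset.mul_sum, ← Finset.mul_sum,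
      ← Finset.sum_mul]
    have hs1 : ∑ q ∈ I, (‖shintaniRes1 (psiMod q) 1‖ + ‖shintaniRes1 (psiMod q) (-1)‖) ≤ Q₁ * (C₁ * (Q₁ : ℝ) ^ (-2 + η)) := by
      calc ∑ q ∈ I, (‖shintaniRes1 (psiMod q) 1‖ + ‖shintaniRes1 (psiMod q) (-1)‖)
          ≤ ∑ _q ∈ I, C₁ * (Q₁ : ℝ) ^ (-2 + η) := Finset.sum_le_sum hR1
        _ = I.card * (C₁ * (Q₁ : ℝ) ^ (-2 + η)) := by rw [Finset.sum_const, nsmul_eq_mul]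
        _ ≤ Q₁ * (C₁ * (Q₁ : ℝ) ^ (-2 + η)) := mul_le_mul_of_nonneg_right hcard (by positivity)
    have hs2 : ∑ q ∈ I, (‖shintaniRes56 (psiMod q) 1‖ + ‖shintaniRes56 (psiMod q) (-1)‖)
        ≤ Q₁ * (C₂ * (Q₁ : ℝ) ^ (-(5 : ℝ) / 3 + η)) := by
      calc ∑ q ∈ I, (‖shintaniRes56 (psiMod q) 1‖ + ‖shintaniRes56 (psiMod q) (-1)‖)
          ≤ ∑ _q ∈ I, C₂ * (Q₁ : ℝ) ^ (-(5 : ℝ) / 3 + η) := Finset.sum_le_sum hR2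
        _ = I.card * (C₂ * (Q₁ : ℝ) ^ (-(5 : ℝ) / 3 + η)) := by rw [Finset.sum_const, nsmul_eq_mul]
        _ ≤ Q₁ * (C₂ * (Q₁ : ℝ) ^ (-(5 : ℝ) / 3 + η)) := mul_le_mul_of_nonneg_right hcard (by positivity)
    have hypos : 0 ≤ y + 1 := by linarith
    gcongr
  -- exponent bookkeeping: each of the four terms is `≤ const · X^{2/3+ε}`
  have hQη : (Q₁ : ℝ) ^ η ≤ (X : ℝ) ^ (η / 3) := by
    calc (Q₁ : ℝ) ^ η ≤ ((X : ℝ) ^ ((1 : ℝ) / 3)) ^ η := Real.rpow_le_rpow hQ0.le hQX3 hη0.le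
      _ = (X : ℝ) ^ (η / 3) := by rw [← Real.rpow_mul hX0.le]; ring_nf
  have hT1 : (y + 1) * (Q₁ * (C₁ * (Q₁ : ℝ) ^ (-2 + η))) ≤ 2 * C₁ * P := by
    have e1 : y * (Q₁ * (Q₁ : ℝ) ^ (-2 + η)) = (X : ℝ) ^ ((2 : ℝ) / 3) * (Q₁ : ℝ) ^ η / 12 := by
      rw [hydef]
      have : (Q₁ : ℝ) * (Q₁ * (Q₁ : ℝ) ^ (-2 + η)) = (Q₁ : ℝ) ^ η := by
        rw [show (Q₁ : ℝ) * (Q₁ * (Q₁ : ℝ) ^ (-2 + η)) = (Q₁ : ℝ) ^ (2 : ℝ) * (Q₁ : ℝ) ^ (-2 + η) by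
          rw [Real.rpow_two]; ring, ← Real.rpow_add hQ0]; ring_nf
      calc (X : ℝ) ^ ((2 : ℝ) / 3) * Q₁ / 12 * (Q₁ * (Q₁ : ℝ) ^ (-2 + η))
          = (X : ℝ) ^ ((2 : ℝ) / 3) * ((Q₁ : ℝ) * (Q₁ * (Q₁ : ℝ) ^ (-2 + η))) / 12 := by ring
        _ = _ := by rw [this]
    have e2 : (X : ℝ) ^ ((2 : ℝ) / 3) * (X : ℝ) ^ (η / 3) ≤ P := by
      rw [← Real.rpow_add hX0, hPdef]
      exact Real.rpow_le_rpow_of_exponent_le hX1 (by linarith)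
    calc (y + 1) * (Q₁ * (C₁ * (Q₁ : ℝ) ^ (-2 + η))) ≤ (13 * y) * (Q₁ * (C₁ * (Q₁ : ℝ) ^ (-2 + η))) := by
          gcongr
      _ = 13 * C₁ * (y * (Q₁ * (Q₁ : ℝ) ^ (-2 + η))) := by ring
      _ = 13 * C₁ * ((X : ℝ) ^ ((2 : ℝ) / 3) * (Q₁ : ℝ) ^ η / 12) := by rw [e1]
      _ ≤ 13 * C₁ * ((X : ℝ) ^ ((2 : ℝ) / 3) * (X : ℝ) ^ (η / 3) / 12) := by gcongr
      _ ≤ 13 * C₁ * (P / 12) := by gcongr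
      _ ≤ 2 * C₁ * P := by have := mul_nonneg hC₁0 hP0.le; linarith
  have hT2 : (y + 1) * (X : ℝ) ^ (-(1 : ℝ) / 6) * (Q₁ * (C₂ * (Q₁ : ℝ) ^ (-(5 : ℝ) / 3 + η))) ≤ 2 * C₂ * P := by
    have e1 : y * (X : ℝ) ^ (-(1 : ℝ) / 6) * (Q₁ * (Q₁ : ℝ) ^ (-(5 : ℝ) / 3 + η)) =
        (X : ℝ) ^ ((1 : ℝ) / 2) * (Q₁ : ℝ) ^ ((1 : ℝ) / 3 + η) / 12 := by
      rw [hydef]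
      have hQ : (Q₁ : ℝ) * (Q₁ * (Q₁ : ℝ) ^ (-(5 : ℝ) / 3 + η)) = (Q₁ : ℝ) ^ ((1 : ℝ) / 3 + η) := by
        rw [show (Q₁ : ℝ) * (Q₁ * (Q₁ : ℝ) ^ (-(5 : ℝ) / 3 + η)) = (Q₁ : ℝ) ^ (2 : ℝ) * (Q₁ : ℝ) ^ (-(5 : ℝ) / 3 + η) by
          rw [Real.rpow_two]; ring, ← Real.rpow_add hQ0]; ring_nf
      have hXp : (X : ℝ) ^ ((2 : ℝ) / 3) * (X : ℝ) ^ (-(1 : ℝ) / 6) = (X : ℝ) ^ ((1 : ℝ) / 2) := by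
        rw [← Real.rpow_add hX0]; norm_num
      calc (X : ℝ) ^ ((2 : ℝ) / 3) * Q₁ / 12 * (X : ℝ) ^ (-(1 : ℝ) / 6) * (Q₁ * (Q₁ : ℝ) ^ (-(5 : ℝ) / 3 + η))
          = ((X : ℝ) ^ ((2 : ℝ) / 3) * (X : ℝ) ^ (-(1 : ℝ) / 6)) * ((Q₁ : ℝ) * (Q₁ * (Q₁ : ℝ) ^ (-(5 : ℝ) / 3 + η))) / 12 := by
            ring
        _ = _ := by rw [hQ, hXp]
    have hQpow : (Q₁ : ℝ) ^ ((1 : ℝ) / 3 + η) ≤ (X : ℝ) ^ (((1 : ℝ) / 3 + η) / 3) := by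
      calc (Q₁ : ℝ) ^ ((1 : ℝ) / 3 + η) ≤ ((X : ℝ) ^ ((1 : ℝ) / 3)) ^ ((1 : ℝ) / 3 + η) :=
            Real.rpow_le_rpow hQ0.le hQX3 (by linarith)
        _ = (X : ℝ) ^ (((1 : ℝ) / 3 + η) / 3) := by rw [← Real.rpow_mul hX0.le]; ring_nf
    have e2 : (X : ℝ) ^ ((1 : ℝ) / 2) * (X : ℝ) ^ (((1 : ℝ) / 3 + η) / 3) ≤ P := by
      rw [← Real.rpow_add hX0, hPdef]
      exact Real.rpow_le_rpow_of_exponent_le hX1 (by linarith)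
    calc (y + 1) * (X : ℝ) ^ (-(1 : ℝ) / 6) * (Q₁ * (C₂ * (Q₁ : ℝ) ^ (-(5 : ℝ) / 3 + η)))
        ≤ (13 * y) * (X : ℝ) ^ (-(1 : ℝ) / 6) * (Q₁ * (C₂ * (Q₁ : ℝ) ^ (-(5 : ℝ) / 3 + η))) := by gcongr
      _ = 13 * C₂ * (y * (X : ℝ) ^ (-(1 : ℝ) / 6) * (Q₁ * (Q₁ : ℝ) ^ (-(5 : ℝ) / 3 + η))) := by ring
      _ = 13 * C₂ * ((X : ℝ) ^ ((1 : ℝ) / 2) * (Q₁ : ℝ) ^ ((1 : ℝ) / 3 + η) / 12) := by rw [e1]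
      _ ≤ 13 * C₂ * ((X : ℝ) ^ ((1 : ℝ) / 2) * (X : ℝ) ^ (((1 : ℝ) / 3 + η) / 3) / 12) := by gcongr
      _ ≤ 13 * C₂ * (P / 12) := by gcongr
      _ ≤ 2 * C₂ * P := by have := mul_nonneg hC₂0 hP0.le; linarith
  have hT3 : (Q₁ : ℝ) ^ (2 + η) ≤ P := by
    calc (Q₁ : ℝ) ^ (2 + η) ≤ ((X : ℝ) ^ ((1 : ℝ) / 3 - ε)) ^ (2 + η) := Real.rpow_le_rpow hQ0.le hQX (by linarith)
      _ = (X : ℝ) ^ (((1 : ℝ) / 3 - ε) * (2 + η)) := by rw [← Real.rpow_mul hX0.le]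
      _ ≤ P := by
          rw [hPdef]
          refine Real.rpow_le_rpow_of_exponent_le hX1 ?_
          have e : ((1 : ℝ) / 3 - ε) * (2 + η) = 2 / 3 + η / 3 - 2 * ε - ε * η := by ring
          rw [e]
          linarith [mul_nonneg hε.le hη0.le]
  have hT4 : (Q₁ : ℝ) ^ (2 + η) * ((X : ℝ) ^ (2 + 4 * η) * y ^ (-(2 + 4 * η))) ≤ (12 : ℝ) ^ (3 : ℝ) * P := by
    -- `y^{−e} = 12^e X^{−2e/3} Q₁^{−e}`, `e = 2 + 4η`
    have hypow : y ^ (-(2 + 4 * η)) = (12 : ℝ) ^ (2 + 4 * η) * ((X : ℝ) ^ ((2 : ℝ) / 3)) ^ (-(2 + 4 * η)) * (Q₁ : ℝ) ^ (-(2 + 4 * η)) := by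
      rw [hydef, Real.div_rpow (by positivity) (by norm_num), Real.mul_rpow (by positivity) hQ0.le,
        Real.rpow_neg (by norm_num : (0 : ℝ) ≤ 12), div_eq_mul_inv, inv_inv]
      ring
    have hXX : (X : ℝ) ^ (2 + 4 * η) * ((X : ℝ) ^ ((2 : ℝ) / 3)) ^ (-(2 + 4 * η)) = (X : ℝ) ^ ((2 + 4 * η) / 3) := by
      rw [← Real.rpow_mul hX0.le, ← Real.rpow_add hX0]; ring_nf
    have hQQ : (Q₁ : ℝ) ^ (2 + η) * (Q₁ : ℝ) ^ (-(2 + 4 * η)) ≤ 1 := by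
      rw [← Real.rpow_add hQ0]
      exact Real.rpow_le_one_of_one_le_of_nonpos hQ1 (by linarith)
    have h12 : (12 : ℝ) ^ (2 + 4 * η) ≤ (12 : ℝ) ^ (3 : ℝ) := Real.rpow_le_rpow_of_exponent_le (by norm_num) (by linarith)
    have hXP : (X : ℝ) ^ ((2 + 4 * η) / 3) ≤ P := by
      rw [hPdef]; exact Real.rpow_le_rpow_of_exponent_le hX1 (by linarith)
    calc (Q₁ : ℝ) ^ (2 + η) * ((X : ℝ) ^ (2 + 4 * η) * y ^ (-(2 + 4 * η)))
        = (12 : ℝ) ^ (2 + 4 * η) * ((X : ℝ) ^ (2 + 4 * η) * ((X : ℝ) ^ ((2 : ℝ) / 3)) ^ (-(2 + 4 * η)))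
            * ((Q₁ : ℝ) ^ (2 + η) * (Q₁ : ℝ) ^ (-(2 + 4 * η))) := by rw [hypow]; ring
      _ = (12 : ℝ) ^ (2 + 4 * η) * (X : ℝ) ^ ((2 + 4 * η) / 3) * ((Q₁ : ℝ) ^ (2 + η) * (Q₁ : ℝ) ^ (-(2 + 4 * η))) := by
          rw [hXX]
      _ ≤ (12 : ℝ) ^ (3 : ℝ) * P * 1 := by
          refine mul_le_mul (mul_le_mul h12 hXP (by positivity) (by positivity)) hQQ (by positivity) (by positivity)
      _ = (12 : ℝ) ^ (3 : ℝ) * P := by ring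
  -- assemble
  refine hsum.trans ?_
  have hfin : (y + 1) * (Q₁ * (C₁ * (Q₁ : ℝ) ^ (-2 + η)))
      + (y + 1) * (X : ℝ) ^ (-(1 : ℝ) / 6) * (Q₁ * (C₂ * (Q₁ : ℝ) ^ (-(5 : ℝ) / 3 + η)))
      + C_P' * (Q₁ : ℝ) ^ (2 + η) * (1 + (X : ℝ) ^ (2 + 4 * η) * y ^ (-(2 + 4 * η)))
      ≤ (2 * C₁ + 2 * C₂ + C_P' * (1 + (12 : ℝ) ^ (3 : ℝ))) * P := by
    have h3 : C_P' * (Q₁ : ℝ) ^ (2 + η) * (1 + (X : ℝ) ^ (2 + 4 * η) * y ^ (-(2 + 4 * η)))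
        ≤ C_P' * (1 + (12 : ℝ) ^ (3 : ℝ)) * P := by
      have e : C_P' * (Q₁ : ℝ) ^ (2 + η) * (1 + (X : ℝ) ^ (2 + 4 * η) * y ^ (-(2 + 4 * η)))
          = C_P' * ((Q₁ : ℝ) ^ (2 + η) + (Q₁ : ℝ) ^ (2 + η) * ((X : ℝ) ^ (2 + 4 * η) * y ^ (-(2 + 4 * η)))) := by ring
      rw [e, show C_P' * (1 + (12 : ℝ) ^ (3 : ℝ)) * P = C_P' * (P + (12 : ℝ) ^ (3 : ℝ) * P) by ring]
      exact mul_le_mul_of_nonneg_left (add_le_add hT3 hT4) hC_P'0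
    calc _ ≤ 2 * C₁ * P + 2 * C₂ * P + C_P' * (1 + (12 : ℝ) ^ (3 : ℝ)) * P := add_le_add (add_le_add hT1 hT2) h3
      _ = _ := by ring
  calc C_y * ((y + 1) * (Q₁ * (C₁ * (Q₁ : ℝ) ^ (-2 + η)))
        + (y + 1) * (X : ℝ) ^ (-(1 : ℝ) / 6) * (Q₁ * (C₂ * (Q₁ : ℝ) ^ (-(5 : ℝ) / 3 + η)))
        + C_P' * (Q₁ : ℝ) ^ (2 + η) * (1 + (X : ℝ) ^ (2 + 4 * η) * y ^ (-(2 + 4 * η))))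
      ≤ C_y * ((2 * C₁ + 2 * C₂ + C_P' * (1 + (12 : ℝ) ^ (3 : ℝ))) * P) := mul_le_mul_of_nonneg_left hfin hCy.le
    _ = C_y * (2 * C₁ + 2 * C₂ + C_P' * (1 + (12 : ℝ) ^ (3 : ℝ))) * (X : ℝ) ^ ((2 : ℝ) / 3 + ε) := by rw [hPdef]; ring

/-! ### The weak Landau–Shintani data and the conclusions -/

/-- **`Thm 2.4 (residues) ∧ (eq:FE) ∧ Prop 5.1 ⟹ LandauShintaniDataWeak s ((α^s+β)(6/π²)²)`** with the real data
`r₁(q) = (α^s + β)∏_{p∣q}(2p⁻² − p⁻⁴)`, `r₂(q) = (6/5)γ^s ∏_{p∣q} 𝒞_p` (as `shintaniFamilyInput_of`), the flat dyadic field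
being `landau_block_weak`. [cite: BhargavaTaniguchiThorne2023, §5 (E₁/E₂ paragraphs) with Thm 2.4 (13)–(15), (eq:res_p2), (21), Prop. 5.1] -/
def landauShintaniDataWeak_of
    (h24 : ∀ q : ℕ, Squarefree q → ∀ sgn : ℤ, (sgn = 1 ∨ sgn = -1) → HasPsiResidues q sgn)
    (hFE : ∀ (M : ℕ) [NeZero M] (Φ : BinaryCubic (ZMod M) → ℂ), (∀ y, 0 ≤ (Φ y).re ∧ (Φ y).im = 0) →
      (∀ γ : Matrix (Fin 2) (Fin 2) (ZMod M), IsUnit γ.det → ∀ y, Φ (twist γ y) = Φ y) → HasShintaniFE Φ) (h51 : ∀ ε : ℝ, 0 < ε → ∃ C : ℝ, DualDensityPsiBound ε C) (hU : btt_uniformity_sqDvd)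
    {s : ℤ} (hs : s = 1 ∨ s = -1) : LandauShintaniDataWeak s (mainConstant s) where
  r₁ q := (shintaniAlpha s + shintaniBeta) * resFactor1 q
  r₂ q := 6 / 5 * (shintaniGamma s * resFactor56 q)
  abs_r₁_le _ hη := exists_r₁_le s hη
  hasSum_moebius_mul_r₁ := hasSum_moebius_mul_r₁ s
  abs_r₂_le _ hη := exists_r₂_le s hη
  landau ε hε := landau_block_weak h24 hFE h51 hU hs ε hε

/-- **Proposition 5.1 from Prop. 4.5, Theorem 2.4 for the `𝟙_{m²d∣Disc}` and the functional equation** (as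
`dualDensityPsiBound_of_thm24div_thm32`, with `divCountBound_of_fe`). [cite: BhargavaTaniguchiThorne2023, Proposition 5.1] -/
theorem dualDensityPsiBound_of_thm24div_fe (hU : btt_uniformity_sqDvd) (hFE : ∀ (M : ℕ) [NeZero M] (Φ : BinaryCubic (ZMod M) → ℂ), (∀ y, 0 ≤ (Φ y).re ∧ (Φ y).im = 0) →
      (∀ γ : Matrix (Fin 2) (Fin 2) (ZMod M), IsUnit γ.det → ∀ y, Φ (twist γ y) = Φ y) → HasShintaniFE Φ)
    (h24div : ∀ d m : ℕ, Squarefree d → Squarefree m → d.Coprime m → (d * m).Coprime 6 →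
      ∀ sgn : ℤ, (sgn = 1 ∨ sgn = -1) → HasDivResidues d m sgn) :
    ∀ ε : ℝ, 0 < ε → ∃ C : ℝ, DualDensityPsiBound ε C := by
  intro ε hε
  obtain ⟨C_B, K_B, hC, hK, hLT⟩ := divCountBound_of_fe hU hFE h24div
  exact dualDensityPsiBound_of_divCountBound hU hC hK hLT (fun q hq f => norm_dualWeight_psiMod_le hq f) hε

/-- **BTT (3) = `btt_fundCubicFieldCount_sum` from Theorem 2.4 alone — the residue formulas (`h24` for `Ψ_{q²}`,
`h24div` for `𝟙_{m²d∣Disc}`) and the functional equation (`hFE`) — together with Proposition 4.5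
(`btt_uniformity_sqDvd`)**: Theorem 3.2 / [LDTT] (Landau's method) and Propositions 5.1–5.2 are now theorems of the
tree. [cite: BhargavaTaniguchiThorne2023, Section 5 (direct proof of (3)) with Thm 2.4 and Thm 3.1–3.2] -/
theorem btt_fundCubicFieldCount_sum_of_thm24_fe
    (h24 : ∀ q : ℕ, Squarefree q → ∀ sgn : ℤ, (sgn = 1 ∨ sgn = -1) → HasPsiResidues q sgn)
    (h24div : ∀ d m : ℕ, Squarefree d → Squarefree m → d.Coprime m → (d * m).Coprime 6 →
      ∀ sgn : ℤ, (sgn = 1 ∨ sgn = -1) → HasDivResidues d m sgn)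
    (hFE : ∀ (M : ℕ) [NeZero M] (Φ : BinaryCubic (ZMod M) → ℂ), (∀ y, 0 ≤ (Φ y).re ∧ (Φ y).im = 0) →
      (∀ γ : Matrix (Fin 2) (Fin 2) (ZMod M), IsUnit γ.det → ∀ y, Φ (twist γ y) = Φ y) → HasShintaniFE Φ) (hU : btt_uniformity_sqDvd) : btt_fundCubicFieldCount_sum := by
  have h51 := dualDensityPsiBound_of_thm24div_fe hU hFE h24div
  have hneg : LandauShintaniDataWeak (-1) (3 / Real.pi ^ 2) :=
    mainConstant_neg_one ▸ landauShintaniDataWeak_of h24 hFE h51 hU (Or.inr rfl)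
  have hpos : LandauShintaniDataWeak 1 (2 / Real.pi ^ 2) :=
    mainConstant_one ▸ landauShintaniDataWeak_of h24 hFE h51 hU (Or.inl rfl)
  exact btt_fundCubicFieldCount_sum_of_landauShintaniWeak hneg hpos hU

/-- … and BTT Theorem 1.2 (`btt_threeTorsion_sum`) with, in addition, the class-field-theory dictionary
`#Cl(ℚ(√D))[3] = 2 N₃(D) + 1`. [cite: BhargavaTaniguchiThorne2023, §5 ((3) ⟺ Thm 1.2)] -/
theorem btt_threeTorsion_sum_of_thm24_fe
    (hdict : threeTorsion_eq_two_mul_cubicFieldCountOfDisc_add_one)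
    (h24 : ∀ q : ℕ, Squarefree q → ∀ sgn : ℤ, (sgn = 1 ∨ sgn = -1) → HasPsiResidues q sgn)
    (h24div : ∀ d m : ℕ, Squarefree d → Squarefree m → d.Coprime m → (d * m).Coprime 6 →
      ∀ sgn : ℤ, (sgn = 1 ∨ sgn = -1) → HasDivResidues d m sgn)
    (hFE : ∀ (M : ℕ) [NeZero M] (Φ : BinaryCubic (ZMod M) → ℂ), (∀ y, 0 ≤ (Φ y).re ∧ (Φ y).im = 0) →
      (∀ γ : Matrix (Fin 2) (Fin 2) (ZMod M), IsUnit γ.det → ∀ y, Φ (twist γ y) = Φ y) → HasShintaniFE Φ) (hU : btt_uniformity_sqDvd) : Literature.NumberTheory.QuadraticFields.btt_threeTorsion_sum :=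
  btt_threeTorsion_sum_holds_of hdict (btt_fundCubicFieldCount_sum_of_thm24_fe h24 h24div hFE hU)

end Literature.NumberTheory.CubicFields

end
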